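/-
COR-CM (cell pub-hodgecm2, stage 2 of the Hodge ladder) — lane V-TRANSPORT (seat b06 gen 22; count-neutral, no
BINDER-OWNERS row, no E term, no display of record; Interfaces (C1) untouched; wording of record untouched).
ROW B `TowerRelabel` of the junction-B01 ideation memo IDEA-1g (b01-idea-1 gen 7, «one tower per field», route L1g-B),
algebraic half: transport of a hermitian 3-space and of its levels along a field automorphism `h` of `L` (the embedding
`ι₁` becomes `ι₁ ∘ h⁻¹`; the complex Gram matrix and the complex arithmetic group do not change).
-/
import Summits.HodgeConjecture.CorCM.CM.Basic
import HarnessLib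

/-!
# COR-CM — relabelling a hermitian 3-space and its levels along an automorphism of the CM field

For a CM field `L`, an embedding `ι₁ : L →+* ℂ`, a ring automorphism `h : L ≃+* L` and `V : HermSpace3 L ι₁`:

* `cmConjRingHom_map_ringEquiv` — complex conjugation of a CM field commutes with every automorphism (Shimura 1998
  §18.2; tree `commute_complexConj_of_isCMField` is the `ℚ`-algebra form; here re-derived in one line from
  `embedding_cmConjRingHom`);
* §1 transport along `h` of the tree's ball-quotient vocabulary on `GL₃(L)`: `unitaryGroup` (`map_mem_unitaryGroup_iff`,
  `unitaryGroup_map_ringEquiv`), `IsCongruentOneMod` (`isCongruentOneMod_map_iff`: `h` preserves `𝓞_L`,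
  Mathlib `RingOfIntegers.mapRingHom`), `principalCongruenceSubgroup` (`principalCongruenceSubgroup_map_ringEquiv`) and
  **`IsCongruenceSubgroup.map_ringEquiv`** (finite index by `Subgroup.relIndex_map_map_of_injective`);
* §2 **`HermSpace3.relabel V h : HermSpace3 L (ι₁ ∘ h⁻¹)`** with Gram matrix `h(V.Hm)`: hermitian (conjugation is central),
  SAME complex Gram matrix at `ι₁ ∘ h⁻¹` (`HermSpace3.relabel_map_ι`), signature `(2,1)` there and positive definite at the
  other places (the places are permuted by `h`);
* §3 **`Level.relabel Γ h : Level (V.relabel h)`** — the level `h(Γ)` (a torsion-free congruence subgroup of `U(h V.Hm)`),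
  paired with its canonical compact open by `Level.ofCongruence`; `Level.relabel_Γ`, and `Level.map_ι_relabel_Γ`: read in
  `GL₃(ℂ)` through `ι₁ ∘ h⁻¹`, `h(Γ)` IS `Γ` read through `ι₁`.

Consumer: `CorCM/TowerRelabel.lean` (the surfaces `P(V.relabel h, Γ.relabel h)` over `ι₁ ∘ h⁻¹` and `P(V, Γ)` over `ι₁` of the
universe of record have literally the same ball datum up to the field relabelling, hence are isomorphic with bijective
pull-backs; `PeriodNV ι₁ V … → PeriodNV (ι₁ ∘ h⁻¹) V' …`).  Two structure-valued `def`s (`HermSpace3.relabel`, `Level.relabel`),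
theorems otherwise; nothing cited as a record, nothing asserted.
-/

noncomputable section

open scoped Matrix ComplexOrder
open NumberField
open Literature.NumberTheory.Automorphic
open Literature.AlgebraicGeometry.ShimuraVarieties

namespace Summit.HodgeConjecture.CorCM

variable {L : CMField}

/-- **Complex conjugation of a CM field commutes with every automorphism**: `c̄ (h x) = h (c̄ x)` (read through any complex
embedding `φ`, both sides are `conj (φ (h x))`; Shimura 1998 §18.2, remark after the Lemma). [folklore] -/
theorem cmConjRingHom_map_ringEquiv (h : L ≃+* L) (x : L) : cmConjRingHom L (h x) = h (cmConjRingHom L x) := by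
  obtain ⟨φ⟩ : Nonempty (L →+* ℂ) := inferInstance
  apply φ.injective
  rw [embedding_cmConjRingHom L φ (h x)]
  have := embedding_cmConjRingHom L (φ.comp h.toRingHom) x
  simpa using this.symm

/-! ### §1 Transport of `unitaryGroup`, `IsCongruentOneMod`, `principalCongruenceSubgroup`, `IsCongruenceSubgroup` along `h` -/

section Transport

variable (h : L ≃+* L)

/-- `GL₃(h)` applied to a matrix: `(GL₃(h) g) = h(g)` entrywise. [folklore] -/
theorem coe_generalLinearGroup_map_ringEquiv (g : GL (Fin 3) L) :
    ((Matrix.GeneralLinearGroup.map h.toRingHom g : GL (Fin 3) L) : Matrix (Fin 3) (Fin 3) L) =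
      (g : Matrix (Fin 3) (Fin 3) L).map h := rfl

/-- The defining matrix of `h(g)` for `U(h H)` is `h` applied to that of `g` for `U(H)`. [folklore] -/
theorem map_unitary_matrix (H : Matrix (Fin 3) (Fin 3) L) (g : Matrix (Fin 3) (Fin 3) L) :
    ((g.map h).map (cmConjRingHom L))ᵀ * H.map h * g.map h = (((g.map (cmConjRingHom L))ᵀ * H * g)).map h := by
  have hc : (g.map h).map (cmConjRingHom L) = (g.map (cmConjRingHom L)).map h := by
    ext i j
    simp only [Matrix.map_apply, cmConjRingHom_map_ringEquiv]
  rw [hc, Matrix.map_mul, Matrix.map_mul, Matrix.transpose_map]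

/-- **`h(g) ∈ U(h H) ↔ g ∈ U(H)`** (apply the injective `h` entrywise to the defining equation). [folklore] -/
theorem map_mem_unitaryGroup_iff (H : Matrix (Fin 3) (Fin 3) L) (g : GL (Fin 3) L) :
    Matrix.GeneralLinearGroup.map h.toRingHom g ∈ unitaryGroup (cmConjRingHom L) (H.map h) ↔
      g ∈ unitaryGroup (cmConjRingHom L) H := by
  rw [mem_unitaryGroup_iff, mem_unitaryGroup_iff, coe_generalLinearGroup_map_ringEquiv, map_unitary_matrix]
  exact (Matrix.map_injective h.injective).eq_iff

/-- `GL₃(h⁻¹) (GL₃(h) g) = g`. [folklore] -/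
theorem generalLinearGroup_map_symm_map (g : GL (Fin 3) L) :
    Matrix.GeneralLinearGroup.map h.symm.toRingHom (Matrix.GeneralLinearGroup.map h.toRingHom g) = g := by
  ext i j
  simp [RingEquiv.toRingHom_eq_coe]

/-- `GL₃(h) (GL₃(h⁻¹) g) = g`. [folklore] -/
theorem generalLinearGroup_map_map_symm (g : GL (Fin 3) L) :
    Matrix.GeneralLinearGroup.map h.toRingHom (Matrix.GeneralLinearGroup.map h.symm.toRingHom g) = g := by
  ext i j
  simp [RingEquiv.toRingHom_eq_coe]

/-- `h⁻¹(h(H)) = H` for matrices. [folklore] -/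
theorem matrix_map_symm_map (H : Matrix (Fin 3) (Fin 3) L) : (H.map h).map h.symm = H := by
  rw [Matrix.map_map]
  convert Matrix.map_id H
  funext x
  exact h.symm_apply_apply x

/-- **`h(U(H)) = U(h H)`** as subgroups of `GL₃(L)`. [folklore] -/
theorem unitaryGroup_map_ringEquiv (H : Matrix (Fin 3) (Fin 3) L) :
    (unitaryGroup (cmConjRingHom L) H).map (Matrix.GeneralLinearGroup.map h.toRingHom) =
      unitaryGroup (cmConjRingHom L) (H.map h) := by
  ext g
  constructor
  · rintro ⟨g₀, hg₀, rfl⟩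
    exact (map_mem_unitaryGroup_iff h H g₀).2 hg₀
  · intro hg
    refine ⟨Matrix.GeneralLinearGroup.map h.symm.toRingHom g, ?_, generalLinearGroup_map_map_symm h g⟩
    have := (map_mem_unitaryGroup_iff h.symm (H.map h) g).2 hg
    rwa [matrix_map_symm_map] at this

/-- **`h` preserves integral congruences**: `g ≡ 1 (mod n)` integrally iff `h(g) ≡ 1 (mod n)` (`h` maps `𝓞_L` onto itself).
[folklore] -/
theorem isCongruentOneMod_map (n : ℕ) {g : Matrix (Fin 3) (Fin 3) L} (hg : IsCongruentOneMod n g) :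
    IsCongruentOneMod n (g.map h) := by
  obtain ⟨A, rfl⟩ := hg
  refine ⟨A.map (RingOfIntegers.mapRingHom h.toRingHom), ?_⟩
  ext i j
  simp only [Matrix.add_apply, Matrix.map_apply, Matrix.one_apply, Matrix.smul_apply, map_add, map_nsmul,
    RingEquiv.toRingHom_eq_coe]
  congr 1
  split_ifs <;> simp

/-- `g ≡ 1 (mod n)` integrally iff `h(g) ≡ 1 (mod n)`. [folklore] -/
theorem isCongruentOneMod_map_iff (n : ℕ) (g : Matrix (Fin 3) (Fin 3) L) :
    IsCongruentOneMod n (g.map h) ↔ IsCongruentOneMod n g := by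
  refine ⟨fun hg ↦ ?_, isCongruentOneMod_map h n⟩
  have := isCongruentOneMod_map h.symm n hg
  rwa [matrix_map_symm_map] at this

/-- **`h(g) ∈ Γ_{hH}(n) ↔ g ∈ Γ_H(n)`** for the principal congruence subgroups. [folklore] -/
theorem map_mem_principalCongruenceSubgroup_iff (H : Matrix (Fin 3) (Fin 3) L) (n : ℕ) (g : GL (Fin 3) L) :
    Matrix.GeneralLinearGroup.map h.toRingHom g ∈ principalCongruenceSubgroup (cmConjRingHom L) (H.map h) n ↔
      g ∈ principalCongruenceSubgroup (cmConjRingHom L) H n := by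
  change _ ∈ unitaryGroup _ _ ∧ IsCongruentOneMod n _ ∧ IsCongruentOneMod n _ ↔
    _ ∈ unitaryGroup _ _ ∧ IsCongruentOneMod n _ ∧ IsCongruentOneMod n _
  rw [map_mem_unitaryGroup_iff, ← map_inv, coe_generalLinearGroup_map_ringEquiv, coe_generalLinearGroup_map_ringEquiv,
    isCongruentOneMod_map_iff, isCongruentOneMod_map_iff]

/-- **`h(Γ_H(n)) = Γ_{hH}(n)`**. [folklore] -/
theorem principalCongruenceSubgroup_map_ringEquiv (H : Matrix (Fin 3) (Fin 3) L) (n : ℕ) :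
    (principalCongruenceSubgroup (cmConjRingHom L) H n).map (Matrix.GeneralLinearGroup.map h.toRingHom) =
      principalCongruenceSubgroup (cmConjRingHom L) (H.map h) n := by
  ext g
  constructor
  · rintro ⟨g₀, hg₀, rfl⟩
    exact (map_mem_principalCongruenceSubgroup_iff h H n g₀).2 hg₀
  · intro hg
    refine ⟨Matrix.GeneralLinearGroup.map h.symm.toRingHom g, ?_, generalLinearGroup_map_map_symm h g⟩
    have := (map_mem_principalCongruenceSubgroup_iff h.symm (H.map h) n g).2 hg
    rwa [matrix_map_symm_map] at this

/-- `GL₃(h)` is injective. [folklore] -/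
theorem generalLinearGroup_map_ringEquiv_injective :
    Function.Injective (Matrix.GeneralLinearGroup.map (n := Fin 3) h.toRingHom) :=
  Function.LeftInverse.injective (generalLinearGroup_map_symm_map h)

/-- **Congruence subgroups are transported by field automorphisms**: if `Γ` is a congruence subgroup of `U(H)` then
`h(Γ)` is a congruence subgroup of `U(h H)` (same level `n`; the finite index is transported along the injective `GL₃(h)`).
[folklore] -/
theorem IsCongruenceSubgroup.map_ringEquiv {H : Matrix (Fin 3) (Fin 3) L} {Γ : Subgroup (GL (Fin 3) L)}
    (hΓ : IsCongruenceSubgroup (cmConjRingHom L) H Γ) :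
    IsCongruenceSubgroup (cmConjRingHom L) (H.map h) (Γ.map (Matrix.GeneralLinearGroup.map h.toRingHom)) := by
  obtain ⟨hU, n, hn, hle, hfin⟩ := hΓ
  refine ⟨?_, n, hn, ?_, ?_⟩
  · rw [← unitaryGroup_map_ringEquiv]
    exact Subgroup.map_mono hU
  · rw [← principalCongruenceSubgroup_map_ringEquiv]
    exact Subgroup.map_mono hle
  · rw [← principalCongruenceSubgroup_map_ringEquiv, Subgroup.finiteIndex_iff]
    have h1 := Subgroup.relIndex_map_map_of_injective (principalCongruenceSubgroup (cmConjRingHom L) H n) Γ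
      (generalLinearGroup_map_ringEquiv_injective h)
    have h2 : (principalCongruenceSubgroup (cmConjRingHom L) H n).relIndex Γ ≠ 0 :=
      (Subgroup.finiteIndex_iff.mp hfin)
    rw [Subgroup.relIndex] at h1 h2
    rw [h1]
    exact h2

/-- Torsion-freeness is transported by field automorphisms. [folklore] -/
theorem torsionFree_map_ringEquiv {Γ : Subgroup (GL (Fin 3) L)} (htf : ∀ γ ∈ Γ, IsOfFinOrder γ → γ = 1) :
    ∀ γ ∈ Γ.map (Matrix.GeneralLinearGroup.map h.toRingHom), IsOfFinOrder γ → γ = 1 := by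
  rintro _ ⟨γ, hγ, rfl⟩ hfin
  have h1 : IsOfFinOrder γ := by
    have := (Matrix.GeneralLinearGroup.map h.symm.toRingHom).isOfFinOrder hfin
    rwa [generalLinearGroup_map_symm_map] at this
  rw [htf γ hγ h1, map_one]

end Transport

/-! ### §2 Relabelling a hermitian 3-space -/

/-- `mk (τ ∘ h) = mk ι₁ → mk τ = mk (ι₁ ∘ h⁻¹)`: places are permuted by `h`. [folklore] -/
theorem InfinitePlace.mk_eq_of_mk_comp_eq {ι₁ τ : L →+* ℂ} (h : L ≃+* L)
    (hτ : InfinitePlace.mk (τ.comp h.toRingHom) = InfinitePlace.mk ι₁) :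
    InfinitePlace.mk τ = InfinitePlace.mk (ι₁.comp h.symm.toRingHom) := by
  have key : ∀ φ : L →+* ℂ, (φ.comp h.toRingHom).comp h.symm.toRingHom = φ := fun φ ↦
    RingHom.ext fun x ↦ by simp
  rcases InfinitePlace.mk_eq_iff.mp hτ with h1 | h1
  · rw [← h1, key]
  · have h2 : ComplexEmbedding.conjugate τ = ι₁.comp h.symm.toRingHom := by
      rw [← h1]
      exact (key _).symm
    rw [← h2, InfinitePlace.mk_conjugate_eq]

namespace HermSpace3

variable {ι₁ : L →+* ℂ}

/-- **Relabelling along `h ∈ Aut(L)`**: the hermitian 3-space over `(L, ι₁ ∘ h⁻¹)` with Gram matrix `h(V.Hm)`.  Its complex Gram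
matrix at `ι₁ ∘ h⁻¹` IS that of `V` at `ι₁`; it is hermitian because complex conjugation is central, of signature `(2,1)` at the
place of `ι₁ ∘ h⁻¹` and positive definite elsewhere because `h` permutes the places.  (Transport of structure; Shih 1978 §4 /
IDEA-1g row B.) [folklore] -/
def relabel (V : HermSpace3 L ι₁) (h : L ≃+* L) : HermSpace3 L (ι₁.comp h.symm.toRingHom) where
  Hm := V.Hm.map h
  isHermitian i j := by
    simp only [Matrix.map_apply, cmConjRingHom_map_ringEquiv, V.isHermitian]
  signature_ι₁ := by
    have hmap : (V.Hm.map h).map (ι₁.comp h.symm.toRingHom) = V.Hm.map ι₁ := by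
      rw [Matrix.map_map]
      congr 1
      funext x
      simp
    rw [hmap]
    exact V.signature_ι₁
  posDef_of_ne τ hτ := by
    have hmap : (V.Hm.map h).map τ = V.Hm.map (τ.comp h.toRingHom) := by
      rw [Matrix.map_map]
      rfl
    rw [hmap]
    exact V.posDef_of_ne (τ.comp h.toRingHom) fun hc ↦ hτ (InfinitePlace.mk_eq_of_mk_comp_eq h hc)

/-- The Gram matrix of the relabelled space is `h(V.Hm)`. [folklore] -/
@[simp] theorem relabel_Hm (V : HermSpace3 L ι₁) (h : L ≃+* L) : (V.relabel h).Hm = V.Hm.map h := rfl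

/-- **Same complex Gram matrix**: `(ι₁ ∘ h⁻¹)(h(V.Hm)) = ι₁(V.Hm)`. [folklore] -/
theorem relabel_map_ι (V : HermSpace3 L ι₁) (h : L ≃+* L) :
    (V.relabel h).Hm.map (ι₁.comp h.symm.toRingHom) = V.Hm.map ι₁ := by
  rw [relabel_Hm, Matrix.map_map]
  congr 1
  funext x
  simp

end HermSpace3

/-! ### §3 Relabelling a level -/

namespace Level

variable {ι₁ : L →+* ℂ} {V : HermSpace3 L ι₁}

/-- **Relabelling a level along `h ∈ Aut(L)`**: the torsion-free congruence subgroup `h(Γ)` of `U(h V.Hm)(L⁺)`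
(`IsCongruenceSubgroup.map_ringEquiv`, `torsionFree_map_ringEquiv`), paired with its canonical compact open
(`Level.ofCongruence`). [folklore] -/
def relabel (Γ : Level V) (h : L ≃+* L) : Level (V.relabel h) :=
  Level.ofCongruence (Γ.Γ.map (Matrix.GeneralLinearGroup.map h.toRingHom))
    (IsCongruenceSubgroup.map_ringEquiv h Γ.isCongruence) (torsionFree_map_ringEquiv h Γ.torsionFree)

/-- The arithmetic group of the relabelled level is `h(Γ)`. [folklore] -/
@[simp] theorem relabel_Γ (Γ : Level V) (h : L ≃+* L) :
    (Γ.relabel h).Γ = Γ.Γ.map (Matrix.GeneralLinearGroup.map h.toRingHom) := rfl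

/-- **Same complex group**: read in `GL₃(ℂ)` through `ι₁ ∘ h⁻¹`, `h(Γ)` is `Γ` read through `ι₁`. [folklore] -/
theorem map_ι_relabel_Γ (Γ : Level V) (h : L ≃+* L) :
    (Γ.relabel h).Γ.map (Matrix.GeneralLinearGroup.map (ι₁.comp h.symm.toRingHom)) =
      Γ.Γ.map (Matrix.GeneralLinearGroup.map ι₁) := by
  rw [relabel_Γ, Subgroup.map_map]
  congr 1
  ext g i j
  simp

end Level

end Summit.HodgeConjecture.CorCM

end
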